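import Literature.NumberTheory.EllipticCurves.ToricTwoVariablePAdicLFunctionUpTo
import Summits.BirchSwinnertonDyer.BirchSwinnertonDyer.Theorems.SchneiderFreeAdditiveX3Defs
import Summits.BirchSwinnertonDyer.Rank1Residual.Additive.PotSupersingularClasses
import HarnessLib
import HarnessLib.Audit.Tags

/-!
# Route `UniversalToricDescent` — light defs module for the research stub (E) `ToricFrameExistsAtThree` (BARE existence of a ♯♯-frame)
# (crux r204 stmt-BirchSwinnertonDyer-24207 `RationalSplitIMCInclusionAtThree`, line `ratwall_thin_comb`, skeleton v11)

Cell `pub/bsd-wall`, LEAD `cruxlead-24207` (g38), 2026-08-30; `--supports stmt-BirchSwinnertonDyer-24207 --as helper`.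
Companion of `UniversalToricDescentNormalisedToricFrameDefs` (g36, the v10 stub (N♭)): this module names the line's ONE un-named stub of skeleton
v11, the BARE existence of a ♯♯-frame of the toric two-variable `3`-adic `L`-function of `f_E` at the additive split `3` — the v5/v6 stub
`stub_toricExistsUpTo2` VERBATIM (= clause (i) of the v7–v8.2 stub `stub_toricExistsSymmUpTo2`) — as ONE constant, so that (a) the line's composition
«(E) ∧ Jacquet's cone fact ∧ Nekovář's fact ∧ `RatThinCombDvdUpToTwoAtThree` ⟹ crux 24207» can be landed sorry-free with ALL FOUR inputs as
hypotheses BY NAME (certificate `…ClosedModuloV87`), (b) a disprover / typer / planner can cite, refute (under `Negative/`) or promote the exact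
statement by name, and (c) the route file can import it without a cycle. WHY v11 CAN DROP THE NORMALISATION of (N)/(N♭): the FRAME FUNCTIONAL
EQUATION `…ThinComb.FrameFunctionalEquation.associated_frameSubst` (g38) proves the symmetry clause `φ_{A_τ}L₂ ∼ L₂` for EVERY ♯♯-frame, with no
condition on its constants. Contains ONLY the `@[conjecture] def … : Prop` (an OPEN statement in our theories — human rule 2026-08-15: tagged
`@[conjecture]`, an obligation node provable / refutable BY NAME, never a Literature fact) and an `Iff.rfl` readback lemma. ROUTE-INDEPENDENT
(no `Theses` import); no instance, no notation, no theorem content, no `sorry`.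

WHAT THE CONSTANT SAYS (E).  For every elliptic `E/ℚ` of class O6 at `3` (wild additive, potentially supersingular sub-class), `ρ̄₃` onto, analytic
rank one, conductor `N`, every imaginary quadratic `K` Heegner for `N` (so `3 = 𝔭𝔭′` splits), every anticyclotomic `ℤ₃`-extension `κ′` with
topological generator `γ`, every embedding datum `ι′ : ℚ̄₃ ≃ ℂ` inducing the degree-one prime `𝔭`, and every `𝔭`-adapted generator pair
`(κ₁, κ₂; γ₁, γ₂)` of the `ℤ₃²`-tower (`κ₁` unramified outside `𝔭`, `γ₁ ≡ γ`, `γ₂ ≡ γ^{3^k}` modulo `ker κ′`): there are a complex CM period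
`Ω_K′ ≠ 0`, constants `C, X, Y ∈ ℂ₃ˣ` and an INTEGRAL two-variable series `L₂ ∈ R₀⟦T₁⟧⟦T₂⟧` (`R₀ = W(𝔽̄₃)`) which is a ♯♯-frame of the toric
two-variable `3`-adic `L`-function of `f_E` with constants `(C, X, Y)` (`IsToricTwoVarLFunctionUpTo₂`): at the point of every everywhere-unramified
Hecke character `ψ` of `K` of type `(a, −b)`, `a, b ≥ 1`, with avatar through the pair and entire `L(f/K, ψ, s)`, `L₂` takes the value
`C·X^a·Y^b · ι′⁻¹(Γ(b)Γ(b+1)/π^{2b+1} · 𝓔(f,ψ) · L(f/K,ψ,1)/Ω_K′^{2(a+b)})`.  NO condition on `Y/X` (the tree proves `‖Y/X‖ = |N|₃` and the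
functional equation for every such frame: `…ThinComb.SizeRigidity`, `…ThinComb.FrameFunctionalEquation`).  SOURCE STATUS: an ADAPTATION, NOT IN
PRINT — Hida, Ann. Inst. Fourier 38 (1988) Thm. 5.1b (any ordinary Λ-adic family, here the CM family through the residually trivial branch, × a
fixed primitive `g = f_E` supercuspidal at `p`; standing `p ≥ 5`) ⊗ Castella–Wan 2023 Thm. 2.11 «Moreover» (CM-period renormalisation), read at
`p = 3`.  (N♭) ⟹ (E) trivially (`…ClosedModuloV87.toricFrameExists_of_normalisedUpToUnit`).  Declaring the constant proves nothing: crux 24207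
stays OPEN and BSD is proved for no curve by this file.

References: [Hida1988AIF] §5 Thm. 5.1b, Lemma 5.2 (ii) (standing p ≥ 5); [CastellaWan2023] §2.4 Thm. 2.11; [HaoLoeffler2025] Thm. 3.5 (shape of the
supercuspidal prefactor; their running assumptions exclude this branch); [SerreAbelianLadic1968] Ch. III §2.3.
-/

noncomputable section

open scoped Classical NumberField

set_option linter.dupNamespace false -- `…BirchSwinnertonDyer.BirchSwinnertonDyer…` is the cell's nested layout (D-0017)
set_option autoImplicit false

namespace Summit.BirchSwinnertonDyer.BirchSwinnertonDyer.Theorems.UniversalToricDescentToricFrameExistsDefs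

open NumberField IsDedekindDomain Field
open Literature.NumberTheory.EllipticCurves

/-- **`ToricFrameExistsAtThree`** ((E) of line `ratwall_thin_comb` on crux 24207 — the stub `stub_toricFrameExists` of skeleton v11 = the v5/v6
stub `stub_toricExistsUpTo2`, VERBATIM as a named `Prop`).  In every `𝔭`-adapted generator pair of the `ℤ₃²`-tower over an imaginary quadratic
Heegner field of a class-O6, `ρ̄₃`-onto, analytic-rank-one `E/ℚ` of conductor `N` (`ι′` inducing the degree-one `𝔭 ∋ 3`, `𝔭′ ≠ 𝔭`), there is a
♯♯-frame `L₂ ∈ R₀⟦T₁⟧⟦T₂⟧` of the toric two-variable `3`-adic `L`-function of `f_E` with SOME constants `(C, X, Y)`, `Ω_K′, C, X, Y ≠ 0`.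
RESEARCH / ADAPTATION (Hida 1988 Thm. 5.1b at `p = 3`; no printed source); a definition only, nothing is proved by it.
[cite: Hida1988AIF, §5 Thm. 5.1b, Lemma 5.2 (ii) (shape of the interpolation; standing p ≥ 5; nothing asserted)]
[cite: CastellaWan2023, §2.4 Thm. 2.11 (arXiv:1607.02019; the display; nothing asserted)] -/
@[conjecture]
def ToricFrameExistsAtThree : Prop :=
    ∀ (W : WeierstrassCurve ℚ) [W.IsElliptic] [W.IsGloballyMinimal] (N : ℕ) [NeZero N] (K : Type) [Field K]
      [NumberField K] (Dt : Literature.NumberTheory.EllipticCurves.ModularForms.ModularParametrizationData W N),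
    Summit.BirchSwinnertonDyer.Rank1Residual.Additive.ClassO6 W 3 → W.HasSurjectiveModNGaloisRep 3 →
    W.analyticRank = 1 → W.conductorNorm ℤ = N → IsImaginaryQuadratic K → SatisfiesHeegnerHypothesis N K →
    ∀ (κ' : ZpExtension K 3), κ'.IsAnticyclotomic → ∀ (γ : Field.absoluteGaloisGroup K) [Fact (κ'.IsTopGenerator γ)]
      (𝔭 : HeightOneSpectrum (𝓞 K)), ((3 : ℕ) : 𝓞 K) ∈ 𝔭.asIdeal →
      𝔭.asIdeal.ramificationIdx (𝓞 ℚ) = 1 → 𝔭.asIdeal.inertiaDeg (𝓞 ℚ) = 1 →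
    ∀ (𝔭' : HeightOneSpectrum (𝓞 K)), ((3 : ℕ) : 𝓞 K) ∈ 𝔭'.asIdeal → 𝔭' ≠ 𝔭 →
    ∀ (ι' : PadicAlgCl 3 ≃+* ℂ), Summit.BirchSwinnertonDyer.BirchSwinnertonDyer.Theorems.SchneiderFree.BranchInducesPrime 3 ι' 𝔭 →
    ∀ (κ₁ κ₂ : ZpExtension K 3) (γ₁ γ₂ : Field.absoluteGaloisGroup K) (k : ℕ)
      [Fact (ZpExtension.IsTopGeneratorPair κ₁ κ₂ γ₁ γ₂)],
    (∀ v : HeightOneSpectrum (𝓞 K), v ≠ 𝔭 → ∀ 𝔓 ∈ v.primesAbove,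
        𝔓.inertia (Field.absoluteGaloisGroup K) ≤ κ₁.kerSubgroup) →
    ZpExtension.pairKer κ₁ κ₂ ≤ κ'.kerSubgroup → γ₁ * γ⁻¹ ∈ κ'.kerSubgroup → γ₂ * (γ ^ (3 ^ k))⁻¹ ∈ κ'.kerSubgroup →
    ∃ (ΩK' : ℂ) (C X Y : ℂ_[3]) (L₂ : PowerSeries (PowerSeries (unrIntegers 3))),
      ΩK' ≠ 0 ∧ C ≠ 0 ∧ X ≠ 0 ∧ Y ≠ 0 ∧
      IsToricTwoVarLFunctionUpTo₂ C X Y ι' 𝔭 𝔭' κ₁ κ₂ γ₁ γ₂ Dt.f ΩK' L₂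

/-- **Readback** (`Iff.rfl`): `ToricFrameExistsAtThree` unfolds to the v5/v6 stub text `stub_toricExistsUpTo2` literally (the hypothesis `hE` of
`…ClosedModuloV87.RationalSplitIMCInclusionAtThree_of_exists_of_jacquet_of_nekovar_of_ratCombDvd`). [cite: Hida1988AIF, §5 Thm. 5.1b (shape; nothing asserted)] -/
theorem toricFrameExistsAtThree_iff :
    ToricFrameExistsAtThree ↔
    ∀ (W : WeierstrassCurve ℚ) [W.IsElliptic] [W.IsGloballyMinimal] (N : ℕ) [NeZero N] (K : Type) [Field K]
      [NumberField K] (Dt : Literature.NumberTheory.EllipticCurves.ModularForms.ModularParametrizationData W N),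
    Summit.BirchSwinnertonDyer.Rank1Residual.Additive.ClassO6 W 3 → W.HasSurjectiveModNGaloisRep 3 →
    W.analyticRank = 1 → W.conductorNorm ℤ = N → IsImaginaryQuadratic K → SatisfiesHeegnerHypothesis N K →
    ∀ (κ' : ZpExtension K 3), κ'.IsAnticyclotomic → ∀ (γ : Field.absoluteGaloisGroup K) [Fact (κ'.IsTopGenerator γ)]
      (𝔭 : HeightOneSpectrum (𝓞 K)), ((3 : ℕ) : 𝓞 K) ∈ 𝔭.asIdeal →
      𝔭.asIdeal.ramificationIdx (𝓞 ℚ) = 1 → 𝔭.asIdeal.inertiaDeg (𝓞 ℚ) = 1 →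
    ∀ (𝔭' : HeightOneSpectrum (𝓞 K)), ((3 : ℕ) : 𝓞 K) ∈ 𝔭'.asIdeal → 𝔭' ≠ 𝔭 →
    ∀ (ι' : PadicAlgCl 3 ≃+* ℂ), Summit.BirchSwinnertonDyer.BirchSwinnertonDyer.Theorems.SchneiderFree.BranchInducesPrime 3 ι' 𝔭 →
    ∀ (κ₁ κ₂ : ZpExtension K 3) (γ₁ γ₂ : Field.absoluteGaloisGroup K) (k : ℕ)
      [Fact (ZpExtension.IsTopGeneratorPair κ₁ κ₂ γ₁ γ₂)],
    (∀ v : HeightOneSpectrum (𝓞 K), v ≠ 𝔭 → ∀ 𝔓 ∈ v.primesAbove,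
        𝔓.inertia (Field.absoluteGaloisGroup K) ≤ κ₁.kerSubgroup) →
    ZpExtension.pairKer κ₁ κ₂ ≤ κ'.kerSubgroup → γ₁ * γ⁻¹ ∈ κ'.kerSubgroup → γ₂ * (γ ^ (3 ^ k))⁻¹ ∈ κ'.kerSubgroup →
    ∃ (ΩK' : ℂ) (C X Y : ℂ_[3]) (L₂ : PowerSeries (PowerSeries (unrIntegers 3))),
      ΩK' ≠ 0 ∧ C ≠ 0 ∧ X ≠ 0 ∧ Y ≠ 0 ∧
      IsToricTwoVarLFunctionUpTo₂ C X Y ι' 𝔭 𝔭' κ₁ κ₂ γ₁ γ₂ Dt.f ΩK' L₂ :=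
  Iff.rfl

end Summit.BirchSwinnertonDyer.BirchSwinnertonDyer.Theorems.UniversalToricDescentToricFrameExistsDefs

end
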